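import Literature.AlgebraicGeometry.Frobenioids.PerfectionCoAngularPreSteps
import Literature.AlgebraicGeometry.Frobenioids.PerfectionEquivalence
import HarnessLib

/-!
# Frobenioids I, Proposition 3.2 (iii) "`C^pf` is a Frobenioid": Definition 1.3 (iii)(d), coslice half,
# for the perfection — zero divisors of co-angular pre-steps out of an object of `C^pf` (PROOFS)

Mochizuki, *The geometry of Frobenioids I: the general theory*, Kyushu J. Math. **62** (2008)
293–400, Definition 1.3 (iii)(d) p. 24 ("the natural functor `^A(C^coa-pre) → Order(Φ(A))` … is an
equivalence of categories"), Proposition 3.2 (iii) p. 59 [cite: MochizukiFrdI2008, Prop. 3.2 (iii) p.59].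

PROOF-ONLY sequel of `PerfectionCoAngularPreSteps.lean` (row `FrdI:Prop3.2(iii)-frobenioid`, Def. 1.3 (iii)
pieces, seat abc-iut-w5-d246), for `C` of Frobenius-isotropic type, over the operations `Perfection.ops hF`
(perfected divisors `Div([ρ]) = ((frob_A)^* Div ρ)^{1/(n·a)} ∈ Φ(Base A)^pf`, abc-iut-L1-d9):

* `iii_d_under_surj_perfection`: every `x = y^{1/N} ∈ Φ^pf(Base (A, n))` is the perfected divisor of a
  co-angular pre-step out of `(A, n)` — Def. 1.3 (iii)(d) of `C` at `A^{(N)}` provides a co-angular pre-step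
  `ρ : A^{(N)} → B` with `(frob_{A,N})^* Div ρ = y^n`, and `(y^n)^{1/(nN)} = y^{1/N}`;
* `iii_d_under_full_perfection`: if `Div φ ∣ Div φ'` for co-angular pre-steps `φ : X → Y`, `φ' : X → Y'`
  of `C^pf`, then `φ' = φ ≫ f` for a co-angular pre-step `f : Y → Y'`.  Printed argument made explicit:
  divisibility of perfected divisors `z₁^{1/M} ∣ z₂^{1/M}` unwinds to `z₁^T ∣ z₂^T` in `Φ(Base A)` for some
  `T ≥ 1` (`exists_pow_dvd_pow_of_mk_dvd_mk`); after transporting both representatives to a common level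
  and then up by the further factor `T` their zero divisors become `T`-th powers (Prop. 1.10 (i),
  `pull_frob_div_lift`), so Def. 1.3 (iii)(d) of `C` applies at that level (domain isotropic, hence the
  transports are co-angular pre-steps of `C`, `isCoAngularPreStep_of_isPreStep_frobPow`).
The slice half ("`(C^coa-pre)_A → Order(Φ(A))^opp`", `invDiv`) is the sequel file.  No new definitions;
nothing here is specific to the abc programme.
-/

namespace Literature.AlgebraicGeometry.Frobenioids

/-! ### Divisibility in the perfection of a commutative monoid -/

namespace Perfection

universe u

/-- Divisibility of classes with the same index in `M^pf` unwinds to divisibility of powers in `M`: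
`z₁^{1/n} ∣ z₂^{1/n}` implies `z₁^T ∣ z₂^T` for some `T ≥ 1`. [cite: MochizukiFrdI2008, §0 p.11] -/
theorem exists_pow_dvd_pow_of_mk_dvd_mk {M : Type u} [CommMonoid M] {z₁ z₂ : M} {n : ℕ+}
    (h : mk z₁ n ∣ mk z₂ n) : ∃ T : ℕ+, z₁ ^ (T : ℕ) ∣ z₂ ^ (T : ℕ) := by
  obtain ⟨w, hw⟩ := h
  obtain ⟨⟨u, K⟩, rfl⟩ := mk_surjective w
  change mk z₂ n = mk z₁ n * mk u K at hw
  rw [mk_mul_mk] at hw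
  obtain ⟨N, hN⟩ := mk_eq_mk_iff.mp hw.symm
  rw [PNat.mul_coe, mul_pow, ← pow_mul, ← pow_mul,
    show (K : ℕ) * ((N : ℕ) * (n : ℕ)) = (N : ℕ) * ((n : ℕ) * (K : ℕ)) by ring] at hN
  exact ⟨N * (n * K), Dvd.intro (u ^ ((n : ℕ) * ((N : ℕ) * (n : ℕ)))) (by rw [PNat.mul_coe, PNat.mul_coe]; exact hN)⟩

end Perfection

namespace PreFrobenioid

namespace Perfection

open CategoryTheory Opposite

universe w v v' u u'

variable {D : Type u} [Category.{v} D] {Φ : Dᵒᵖ ⥤ CommMonCat.{w}}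
  {C : Type u'} [Category.{v'} C] {F : C ⥤ ElemFrobenioid Φ} {hF : IsFrobenioid F}

/-! ### Bookkeeping: composites at aligned levels, divisors under transport -/

/-- `[σ] ≫ [τ] = [σ ≫ τ]` for representatives at ALIGNED levels `(a, b)`, `(b, c)`.
[cite: MochizukiFrdI2008, Def. 3.1 (iii) p.57] -/
theorem mk_comp_mk_aligned {X Y Z : Perfection hF} (a b c : ℕ+) (hab : X.idx * a = Y.idx * b)
    (hbc : Y.idx * b = Z.idx * c) (σ : frobPow hF X.obj a ⟶ frobPow hF Y.obj b)
    (τ : frobPow hF Y.obj b ⟶ frobPow hF Z.obj c) :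
    (Hom.mk (⟨⟨a, b, hab⟩, σ⟩ : Rep X Y) ≫ Hom.mk (⟨⟨b, c, hbc⟩, τ⟩ : Rep Y Z) : X ⟶ Z) =
      Hom.mk ⟨⟨a, c, hab.trans hbc⟩, σ ≫ τ⟩ := by
  have e := mk_compAt (⟨a, b, c, hab, hbc⟩ : Level₃ X Y Z) ⟨⟨a, b, hab⟩, σ⟩ ⟨⟨b, c, hbc⟩, τ⟩
    (Level.le_rfl _) (Level.le_rfl _)
  rw [mk_comp_mk, ← e]
  unfold compAt
  rw [Level.lift_rfl, Level.lift_rfl]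

/-- Under transport to a higher level the (pulled-back) zero divisor of a representative is raised to the
degree of the transition (Prop. 1.10 (i): "`Div(φ′) = d · α_* Div(φ)`").
[cite: MochizukiFrdI2008, Prop. 1.10 (i) p.34] -/
theorem pull_frob_div_lift {X Y : Perfection hF} (r : Rep X Y) (L : Level X Y) (h : r.L.LE L) :
    pull Φ (Base F (frob hF X.obj L.a)) (Div F (Level.lift r.L L h r.hom)) =
      pull Φ (Base F (frob hF X.obj r.L.a)) (Div F r.hom) ^ (PreFrobenioid.degFr F (frobTrans hF Y.obj h.2) : ℕ) := by
  have hα := isFrobeniusType_frobTrans hF X.obj h.1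
  have hβ := isFrobeniusType_frobTrans hF Y.obj h.2
  haveI : IsIso (Base F (frobTrans hF X.obj h.1)) := hα.2
  have hdiv := div_frobeniusConjugate (Level.lift_spec r.L L h r.hom) hα hβ
  rw [hdiv, map_pow, ← frob_frobTrans hF X.obj h.1, base_comp, ← pull_comp, Category.assoc,
    IsIso.hom_inv_id, Category.comp_id]

/-- The degree of the transition at the target of the scaled level `(a·T, b·T)` is `T`.
[cite: MochizukiFrdI2008, Def. 3.1 (ii) p.56] -/
theorem degFr_frobTrans_mul (B : C) (b T : ℕ+) (h : b ∣ b * T) :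
    PreFrobenioid.degFr F (frobTrans hF B h) = T :=
  mul_left_cancel (degFr_frobTrans hF B h)

/-- Pull-back along the (invertible) base of a chosen Frobenius arrow reflects divisibility.
[cite: MochizukiFrdI2008, Def. 1.1 (ii) p.19] -/
theorem dvd_of_pull_frob_dvd {A : C} {a : ℕ+} {x y : Φ.obj (op (baseObj F (frobPow hF A a)))}
    (h : pull Φ (Base F (frob hF A a)) x ∣ pull Φ (Base F (frob hF A a)) y) : x ∣ y := by
  haveI := isIso_base_frob hF A a
  have h' := map_dvd (pull Φ (inv (Base F (frob hF A a)))) h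
  rwa [← pull_comp, ← pull_comp, IsIso.inv_hom_id, pull_id, pull_id] at h'

/-! ### Definition 1.3 (iii)(d), coslice, essential surjectivity -/

/-- **Def. 1.3 (iii)(d) for `C^pf`, coslice, essentially surjective** (for `C` of Frobenius-isotropic type):
every element of `Φ^pf(Base X)` is the perfected zero divisor of a co-angular pre-step out of `X`.
[cite: MochizukiFrdI2008, Prop. 3.2 (iii) p.59] -/
theorem iii_d_under_surj_perfection (hiso : IsOfType (IsFrobeniusIsotropic F)) (X : Perfection hF)
    (x : (ops hF).Mon ((ops hF).base.obj X)) :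
    ∃ (Y : Perfection hF) (φ : X ⟶ Y), (ops hF).IsCoAngularPreStep φ ∧ (ops hF).div φ = x := by
  change Frobenioids.Perfection (Φ.obj (op (baseObj F X.obj))) at x
  obtain ⟨⟨y, N⟩, rfl⟩ := Frobenioids.Perfection.mk_surjective x
  haveI := isIso_base_frob hF X.obj N
  -- a co-angular pre-step out of `A^{(N)}` with the prescribed divisor
  obtain ⟨B, ρ, hρ, hdiv⟩ := hF.iii_d_under_surj (frobPow hF X.obj N)
    (pull Φ (inv (Base F (frob hF X.obj N))) (y ^ (X.idx : ℕ)))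
  haveI := isIso_frob_one (hF := hF) B
  -- its class `(A, n) → (B, n·N)` at the level `(N, 1)`
  let Y : Perfection hF := ⟨B, X.idx * N⟩
  have hlev : X.idx * N = Y.idx * 1 := (mul_one _).symm
  have hpre : IsPreStep F (ρ ≫ frob hF B 1) :=
    IsPreStep.comp F hρ.2 ⟨degFr_frob hF B 1, (isFrobeniusType_frob hF B 1).2⟩
  refine ⟨Y, Hom.mk ⟨⟨N, 1, hlev⟩, ρ ≫ frob hF B 1⟩,
    ⟨isCoAngular_of_frobeniusIsotropic hiso _, (isPreStep_mk_iff (⟨⟨N, 1, hlev⟩, _⟩ : Rep X Y)).mpr hpre⟩, ?_⟩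
  -- the perfected divisor
  change Frobenioids.Perfection.mk (pull Φ (Base F (frob hF X.obj N)) (Div F (ρ ≫ frob hF B 1))) (X.idx * N) =
    Frobenioids.Perfection.mk y N
  rw [div_comp, show Div F (frob hF B 1) = 1 from (isFrobeniusType_frob hF B 1).1.2, map_one, one_mul,
    degFr_frob, PNat.one_coe, pow_one, hdiv, ← pull_comp, IsIso.hom_inv_id, pull_id, mul_comm X.idx N,
    Frobenioids.Perfection.mk_pow_mul]

/-! ### Definition 1.3 (iii)(d), coslice, fullness -/

/-- **Def. 1.3 (iii)(d) for `C^pf`, coslice, full** (for `C` of Frobenius-isotropic type): for co-angular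
pre-steps `φ : X → Y`, `φ' : X → Y'` of `C^pf` with `Div φ ∣ Div φ'` in `Φ^pf(Base X)` there is a
co-angular pre-step `f : Y → Y'` with `φ ≫ f = φ'`. [cite: MochizukiFrdI2008, Prop. 3.2 (iii) p.59] -/
theorem iii_d_under_full_perfection (hiso : IsOfType (IsFrobeniusIsotropic F)) ⦃X Y Y' : Perfection hF⦄
    (φ : X ⟶ Y) (φ' : X ⟶ Y') (hφ : (ops hF).IsCoAngularPreStep φ) (hφ' : (ops hF).IsCoAngularPreStep φ')
    (hdvd : (ops hF).div φ ∣ (ops hF).div φ') :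
    ∃ f : Y ⟶ Y', (ops hF).IsCoAngularPreStep f ∧ φ ≫ f = φ' := by
  obtain ⟨⟨⟨a₁, b₁, hab₁⟩, ρ₁⟩, rfl⟩ := Hom.mk_surjective φ
  obtain ⟨⟨⟨a₂, b₂, hab₂⟩, ρ₂⟩, rfl⟩ := Hom.mk_surjective φ'
  have hρ₁ : IsPreStep F ρ₁ := (isPreStep_mk_iff (⟨⟨a₁, b₁, hab₁⟩, ρ₁⟩ : Rep X Y)).mp hφ.2
  have hρ₂ : IsPreStep F ρ₂ := (isPreStep_mk_iff (⟨⟨a₂, b₂, hab₂⟩, ρ₂⟩ : Rep X Y')).mp hφ'.2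
  obtain ⟨A', φ₀, hφ₀, hA'⟩ := hiso X.obj
  -- STEP 1: a common source exponent `E = a₁·a₂·d`
  have hd : PreFrobenioid.degFr F φ₀ ∣ a₁ * a₂ * PreFrobenioid.degFr F φ₀ := dvd_mul_left _ _
  have hE₁ : X.idx * (a₁ * a₂ * PreFrobenioid.degFr F φ₀) = Y.idx * (b₁ * (a₂ * PreFrobenioid.degFr F φ₀)) := by
    rw [mul_assoc, ← mul_assoc X.idx, hab₁, mul_assoc]
  have hE₂ : X.idx * (a₁ * a₂ * PreFrobenioid.degFr F φ₀) = Y'.idx * (b₂ * (a₁ * PreFrobenioid.degFr F φ₀)) := by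
    rw [mul_comm a₁ a₂, mul_assoc, ← mul_assoc X.idx, hab₂, mul_assoc]
  have h₁E : Level.LE (⟨a₁, b₁, hab₁⟩ : Level X Y) ⟨_, _, hE₁⟩ :=
    ⟨(dvd_mul_right a₁ a₂).mul_right _, dvd_mul_right _ _⟩
  have h₂E : Level.LE (⟨a₂, b₂, hab₂⟩ : Level X Y') ⟨_, _, hE₂⟩ :=
    ⟨(dvd_mul_left a₂ a₁).mul_right _, dvd_mul_right _ _⟩
  generalize a₁ * a₂ * PreFrobenioid.degFr F φ₀ = E at hd hE₁ hE₂ h₁E h₂E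
  generalize b₁ * (a₂ * PreFrobenioid.degFr F φ₀) = B₁ at hE₁ h₁E
  generalize b₂ * (a₁ * PreFrobenioid.degFr F φ₀) = B₂ at hE₂ h₂E
  rw [← Hom.mk_lift (⟨⟨a₁, b₁, hab₁⟩, ρ₁⟩ : Rep X Y) ⟨E, B₁, hE₁⟩ h₁E] at hdvd ⊢
  rw [← Hom.mk_lift (⟨⟨a₂, b₂, hab₂⟩, ρ₂⟩ : Rep X Y') ⟨E, B₂, hE₂⟩ h₂E] at hdvd ⊢
  have hR₁ : IsPreStep F (Level.lift (⟨a₁, b₁, hab₁⟩ : Level X Y) ⟨E, B₁, hE₁⟩ h₁E ρ₁) :=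
    (isPreStep_lift_iff (⟨⟨a₁, b₁, hab₁⟩, ρ₁⟩ : Rep X Y) _ h₁E).mpr hρ₁
  have hR₂ : IsPreStep F (Level.lift (⟨a₂, b₂, hab₂⟩ : Level X Y') ⟨E, B₂, hE₂⟩ h₂E ρ₂) :=
    (isPreStep_lift_iff (⟨⟨a₂, b₂, hab₂⟩, ρ₂⟩ : Rep X Y') _ h₂E).mpr hρ₂
  generalize Level.lift (⟨a₁, b₁, hab₁⟩ : Level X Y) ⟨E, B₁, hE₁⟩ h₁E ρ₁ = R₁ at hR₁ hdvd ⊢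
  generalize Level.lift (⟨a₂, b₂, hab₂⟩ : Level X Y') ⟨E, B₂, hE₂⟩ h₂E ρ₂ = R₂ at hR₂ hdvd ⊢
  -- STEP 2: unwind the divisibility of perfected divisors to `z₁^T ∣ z₂^T`
  change Frobenioids.Perfection.mk (pull Φ (Base F (frob hF X.obj E)) (Div F R₁)) (X.idx * E) ∣
    Frobenioids.Perfection.mk (pull Φ (Base F (frob hF X.obj E)) (Div F R₂)) (X.idx * E) at hdvd
  obtain ⟨T, hT⟩ := Frobenioids.Perfection.exists_pow_dvd_pow_of_mk_dvd_mk hdvd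
  -- STEP 3: go up by `T`: the divisors become `T`-th powers
  have hET₁ : X.idx * (E * T) = Y.idx * (B₁ * T) := by rw [← mul_assoc, hE₁, mul_assoc]
  have hET₂ : X.idx * (E * T) = Y'.idx * (B₂ * T) := by rw [← mul_assoc, hE₂, mul_assoc]
  have h₁T : Level.LE (⟨E, B₁, hE₁⟩ : Level X Y) ⟨E * T, B₁ * T, hET₁⟩ := ⟨dvd_mul_right _ _, dvd_mul_right _ _⟩
  have h₂T : Level.LE (⟨E, B₂, hE₂⟩ : Level X Y') ⟨E * T, B₂ * T, hET₂⟩ := ⟨dvd_mul_right _ _, dvd_mul_right _ _⟩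
  have hdiv₁ := pull_frob_div_lift (⟨⟨E, B₁, hE₁⟩, R₁⟩ : Rep X Y) ⟨E * T, B₁ * T, hET₁⟩ h₁T
  have hdiv₂ := pull_frob_div_lift (⟨⟨E, B₂, hE₂⟩, R₂⟩ : Rep X Y') ⟨E * T, B₂ * T, hET₂⟩ h₂T
  rw [degFr_frobTrans_mul] at hdiv₁ hdiv₂
  change pull Φ (Base F (frob hF X.obj (E * T))) (Div F (Level.lift _ _ h₁T R₁)) =
    pull Φ (Base F (frob hF X.obj E)) (Div F R₁) ^ (T : ℕ) at hdiv₁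
  change pull Φ (Base F (frob hF X.obj (E * T))) (Div F (Level.lift _ _ h₂T R₂)) =
    pull Φ (Base F (frob hF X.obj E)) (Div F R₂) ^ (T : ℕ) at hdiv₂
  rw [← hdiv₁, ← hdiv₂] at hT
  have hT' := dvd_of_pull_frob_dvd hT
  -- STEP 4: Def. 1.3 (iii)(d) of `C` at `A^{(E·T)}` (isotropic, so the transports are co-angular pre-steps)
  have hS₁ : IsCoAngularPreStep F (Level.lift (⟨E, B₁, hE₁⟩ : Level X Y) ⟨E * T, B₁ * T, hET₁⟩ h₁T R₁) :=
    isCoAngularPreStep_of_isPreStep_frobPow hφ₀ hA' (hd.mul_right T)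
      ((isPreStep_lift_iff (⟨⟨E, B₁, hE₁⟩, R₁⟩ : Rep X Y) _ h₁T).mpr hR₁)
  have hS₂ : IsCoAngularPreStep F (Level.lift (⟨E, B₂, hE₂⟩ : Level X Y') ⟨E * T, B₂ * T, hET₂⟩ h₂T R₂) :=
    isCoAngularPreStep_of_isPreStep_frobPow hφ₀ hA' (hd.mul_right T)
      ((isPreStep_lift_iff (⟨⟨E, B₂, hE₂⟩, R₂⟩ : Rep X Y') _ h₂T).mpr hR₂)
  obtain ⟨f₀, hf₀, hcomp⟩ := hF.iii_d_under_full _ _ hS₁ hS₂ hT'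
  -- STEP 5: the class of `f₀` at the level `(B₁·T, B₂·T)`
  have hY : Y.idx * (B₁ * T) = Y'.idx * (B₂ * T) := hET₁.symm.trans hET₂
  refine ⟨Hom.mk ⟨⟨B₁ * T, B₂ * T, hY⟩, f₀⟩,
    ⟨isCoAngular_of_frobeniusIsotropic hiso _,
      (isPreStep_mk_iff (⟨⟨B₁ * T, B₂ * T, hY⟩, f₀⟩ : Rep Y Y')).mpr hf₀.2⟩, ?_⟩
  rw [← Hom.mk_lift (⟨⟨E, B₁, hE₁⟩, R₁⟩ : Rep X Y) ⟨E * T, B₁ * T, hET₁⟩ h₁T,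
    ← Hom.mk_lift (⟨⟨E, B₂, hE₂⟩, R₂⟩ : Rep X Y') ⟨E * T, B₂ * T, hET₂⟩ h₂T]
  rw [mk_comp_mk_aligned]
  exact congrArg (fun g => Hom.mk (⟨⟨E * T, B₂ * T, hET₂⟩, g⟩ : Rep X Y')) hcomp

end Perfection

end PreFrobenioid

end Literature.AlgebraicGeometry.Frobenioids
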